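import Summits.QuantumFields.YangMills.Theorems.AllWindowsColdBoxBoxHighLineEdgeChartHyper

/-!
# Even moments and polynomial tails of certified-polynomial chart observables under the Hodge Gaussian (`gaussAvg` letters)
# — a generic tool for the recorded lifts L3/L4 of U5 (`Cruxes/BoxWindowHighSU2213/U5-BLOCKERS.md` §2; LINE-20 U5 ⟨stmt-QuantumFields-24336⟩,
#   LINE-19 S5 ⟨24004⟩/⟨24335⟩)

Width seat `ym-line-sfw-p2-w5` (prover-ym-line-sfw-p2-w5-g23-0).  w5 g22's flat-chart hypercontractivity
✓`Hypercontractivity.integral_pow_mul_exp_quadForm_le_of_polyDeg` (`Z^{r−1}∫F^{2r}e ≤ (2r−1)^{rd}(∫F²e)^r`, Bonami–Nelson–Gross) is transported to the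
edge chart `a : LandauFree H → ℝ³` along ✓`flatten` with `P = hodgeQ H ⊗ₖ 1` (exactly as LEAD's ✓`gaussAvg_sq_mul_sq_le_of_polyCert` does for `F²G²`),
for observables carrying the ✓`polyCert` certificate `∃ Q : MvPolynomial (LandauFree H × Fin 3) ℝ, Q.totalDegree ≤ d ∧ ∀ a, F a = eval (flatten a) Q`:

* ★ `gaussAvg_pow_even_le_of_polyCert` — `E₀[F^{2r}] ≤ (2r−1)^{r·d} · E₀[F²]^r` for every `r ≥ 1` (the `(2,2r)` wrapper; `r = 3` is L3's `‖·‖₆`);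
* ★ `gaussAvg_indicator_le_pow_of_polyCert` — Chebyshev on the even moment: for `λ > 0` and ANY event `A` with `λ ≤ |F|` on `A`
  (`{λ ≤ |F|}`, `{λ < |F|}`, …; no measurability needed), `E₀[1_A] ≤ (2r−1)^{r·d} · E₀[F²]^r / λ^{2r}` (every `r ≥ 1`; the consumer optimises `r` —
  L4's probabilistic cubic cut `P₀(|V₃^{poly}| > 1)` with `E₀[V₃²] ≲ H⁴(1+log H)^m/β`);
* `gaussAvg_indicator_le_pow_of_polyCert_of_le` — the same with a variance bound `E₀[F²] ≤ σ₂` plugged in;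
* `gaussAvg_sfInd_mul_indicator_le_pow_of_polyCert` — the restricted form (`0 ≤ sfInd ≤ 1`).

Everything proved; tree + Mathlib; no definitions; standard axioms.  HONEST LABEL: a generic Gaussian tool for the NEXT rung U5 (unstaffed, gated) and
for S5-type bookkeeping; S5/T-S5.13, U5, ⟨24004⟩ ⟨24335⟩ ⟨24336⟩ remain OPEN; no crux, rung or summit is proved; **the Yang–Mills mass gap is NOT proved
by this file; no summit is proved by a line.**
-/

set_option autoImplicit false

noncomputable section

open MeasureTheory Matrix Finset
open scoped Kronecker

namespace Summit.QuantumFields.YangMills.Theorems.AllWindowsColdBoxBoxHighLine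

namespace EdgeChartGaussian

open LaplaceSandwich (flatten flatten_apply volume_preserving_flatten)
open GaussianChartWick

/-! ## Even moments -/

/-- ★ **`(2,2r)`-hypercontractivity in `gaussAvg` letters**: for a chart observable `F` certified polynomial of degree `≤ d` in the flat variables
and `r ≥ 1`, `E₀[F^{2r}] ≤ (2r−1)^{r·d} · E₀[F²]^r`. -/
theorem gaussAvg_pow_even_le_of_polyCert (H : ℕ) {β : ℝ} (hβ : 0 < β) {F : (LandauFree H → E3) → ℝ} {d : ℕ}
    (hF : ∃ Q : MvPolynomial (LandauFree H × Fin 3) ℝ, Q.totalDegree ≤ d ∧ ∀ a, F a = MvPolynomial.eval (flatten (LandauFree H) a) Q)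
    (r : ℕ) (hr : 1 ≤ r) :
    gaussAvg β H (fun a => F a ^ (2 * r)) ≤ (2 * r - 1 : ℝ) ^ (r * d) * gaussAvg β H (fun a => F a ^ 2) ^ r := by
  obtain ⟨Q, hQ, hFQ⟩ := hF
  set L := hodgeQ H ⊗ₖ (1 : Matrix (Fin 3) (Fin 3) ℝ) with hL
  have hLpd : L.PosDef := posDef_kronecker_one (o := Fin 3) (hodgeQ H) (hodgeQ_posDef H)
  -- move the integrals to the flat chart
  have hI : ∀ Φ : (LandauFree H × Fin 3 → ℝ) → ℝ,
      (∫ a : LandauFree H → E3, Φ (flatten (LandauFree H) a) * gaussWeight β H a) =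
        ∫ v : LandauFree H × Fin 3 → ℝ, Φ v * Real.exp (-(β * (v ⬝ᵥ L *ᵥ v))) := by
    intro Φ
    rw [← integral_eq_flat]
    refine integral_congr_ae (Filter.Eventually.of_forall fun a => ?_)
    simp only [gaussWeight_eq, colourForm_eq_flat, hL]
  have hZ : (∫ a : LandauFree H → E3, gaussWeight β H a) = ∫ v : LandauFree H × Fin 3 → ℝ, Real.exp (-(β * (v ⬝ᵥ L *ᵥ v))) := by
    have h := hI (fun _ => 1)
    simpa only [one_mul] using h
  have hk : ∀ k : ℕ, (∫ a : LandauFree H → E3, F a ^ k * gaussWeight β H a) =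
      ∫ v : LandauFree H × Fin 3 → ℝ, MvPolynomial.eval v Q ^ k * Real.exp (-(β * (v ⬝ᵥ L *ᵥ v))) := by
    intro k
    rw [← hI (fun v => MvPolynomial.eval v Q ^ k)]
    exact integral_congr_ae (Filter.Eventually.of_forall fun a => by simp only [hFQ])
  have hmain := Hypercontractivity.integral_pow_mul_exp_quadForm_le_of_polyDeg L hLpd hβ
    (F := fun v => MvPolynomial.eval v Q) ⟨Q, hQ, fun _ => rfl⟩ r hr
  rw [← integral_exp_neg_quadForm' L hLpd hβ] at hmain
  have hZpos := integral_gaussWeight_pos H hβ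
  unfold gaussAvg
  rw [hk (2 * r), hk 2, hZ]
  rw [hZ] at hZpos
  set A := ∫ v : LandauFree H × Fin 3 → ℝ, MvPolynomial.eval v Q ^ (2 * r) * Real.exp (-(β * (v ⬝ᵥ L *ᵥ v))) with hA
  set B := ∫ v : LandauFree H × Fin 3 → ℝ, MvPolynomial.eval v Q ^ 2 * Real.exp (-(β * (v ⬝ᵥ L *ᵥ v))) with hB
  set Z := ∫ v : LandauFree H × Fin 3 → ℝ, Real.exp (-(β * (v ⬝ᵥ L *ᵥ v))) with hZdef
  -- `Z^{r−1}·A ≤ (2r−1)^{rd}·B^r`  ⇒  `A/Z ≤ (2r−1)^{rd}·(B/Z)^r`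
  have hr' : r - 1 + 1 = r := Nat.sub_add_cancel hr
  have hZr : 0 < Z ^ r := pow_pos hZpos r
  have e1 : A / Z = Z ^ (r - 1) * A / Z ^ r := by
    rw [div_eq_div_iff hZpos.ne' hZr.ne']
    conv_lhs => rw [← hr', pow_succ]
    ring
  rw [e1, div_pow]
  calc Z ^ (r - 1) * A / Z ^ r ≤ (2 * r - 1 : ℝ) ^ (r * d) * B ^ r / Z ^ r := div_le_div_of_nonneg_right hmain hZr.le
    _ = (2 * r - 1 : ℝ) ^ (r * d) * (B ^ r / Z ^ r) := by ring

/-! ## Polynomial tails (Chebyshev on the even moments) -/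

/-- Pointwise Chebyshev: `1_A ≤ F^{2r}/λ^{2r}` for `λ > 0` whenever `λ ≤ |F|` on `A` (e.g. `A = {λ ≤ |F|}` or `{λ < |F|}`). -/
theorem indicator_le_pow_div {Ω : Type*} (F : Ω → ℝ) {A : Set Ω} {lam : ℝ} (hlam : 0 < lam) (hA : ∀ a ∈ A, lam ≤ |F a|) (r : ℕ) (a : Ω) :
    A.indicator (fun _ => (1 : ℝ)) a ≤ F a ^ (2 * r) / lam ^ (2 * r) := by
  by_cases ha : a ∈ A
  · rw [Set.indicator_of_mem ha]
    have hle : lam ≤ |F a| := hA a ha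
    have h1 : 1 ≤ |F a| / lam := by rw [le_div_iff₀ hlam, one_mul]; exact hle
    have h2 : (1 : ℝ) ≤ (|F a| / lam) ^ (2 * r) := one_le_pow₀ h1
    rw [div_pow, (even_two_mul r).pow_abs] at h2
    exact h2
  · rw [Set.indicator_of_notMem ha]
    have : 0 ≤ F a ^ (2 * r) := (even_two_mul r).pow_nonneg _
    positivity

/-- ★ **Polynomial tail**: for `F` certified polynomial of degree `≤ d`, `λ > 0`, `r ≥ 1` and any event `A` on which `λ ≤ |F|`
(e.g. `A = {a | λ ≤ |F a|}` or `{a | λ < |F a|}`; no measurability of `A` needed):  `E₀[1_A] ≤ (2r−1)^{r·d} · E₀[F²]^r / λ^{2r}`. -/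
theorem gaussAvg_indicator_le_pow_of_polyCert (H : ℕ) {β : ℝ} (hβ : 0 < β) {F : (LandauFree H → E3) → ℝ} {d : ℕ}
    (hF : ∃ Q : MvPolynomial (LandauFree H × Fin 3) ℝ, Q.totalDegree ≤ d ∧ ∀ a, F a = MvPolynomial.eval (flatten (LandauFree H) a) Q)
    {A : Set (LandauFree H → E3)} {lam : ℝ} (hlam : 0 < lam) (hA : ∀ a ∈ A, lam ≤ |F a|) (r : ℕ) (hr : 1 ≤ r) :
    gaussAvg β H (A.indicator fun _ => (1 : ℝ)) ≤
      (2 * r - 1 : ℝ) ^ (r * d) * gaussAvg β H (fun a => F a ^ 2) ^ r / lam ^ (2 * r) := by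
  have hint : Integrable fun a : LandauFree H → E3 => F a ^ (2 * r) * gaussWeight β H a :=
    integrable_polyCert_mul_gaussWeight H hβ (polyCert_pow hF (2 * r))
  have hdom : Integrable fun a : LandauFree H → E3 => (lam ^ (2 * r))⁻¹ * F a ^ (2 * r) * gaussWeight β H a := by
    have := hint.const_mul ((lam ^ (2 * r))⁻¹)
    exact this.congr (Filter.Eventually.of_forall fun a => by ring)
  have hmono := gaussAvg_mono_of_nonneg H hβ (F := A.indicator fun _ => (1 : ℝ))
    (G := fun a => (lam ^ (2 * r))⁻¹ * F a ^ (2 * r))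
    (fun a => Set.indicator_nonneg (fun _ _ => zero_le_one) a)
    (fun a => (indicator_le_pow_div F hlam hA r a).trans (le_of_eq (by ring))) hdom
  rw [gaussAvg_const_mul] at hmono
  have hpow := gaussAvg_pow_even_le_of_polyCert H hβ hF r hr
  have hl0 : 0 < (lam ^ (2 * r))⁻¹ := by positivity
  calc gaussAvg β H (A.indicator fun _ => (1 : ℝ))
      ≤ (lam ^ (2 * r))⁻¹ * gaussAvg β H (fun a => F a ^ (2 * r)) := hmono
    _ ≤ (lam ^ (2 * r))⁻¹ * ((2 * r - 1 : ℝ) ^ (r * d) * gaussAvg β H (fun a => F a ^ 2) ^ r) :=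
        mul_le_mul_of_nonneg_left hpow hl0.le
    _ = (2 * r - 1 : ℝ) ^ (r * d) * gaussAvg β H (fun a => F a ^ 2) ^ r / lam ^ (2 * r) := by
        rw [div_eq_mul_inv]; ring

/-- **Polynomial tail with a variance bound plugged in**: `E₀[F²] ≤ σ₂` ⇒ `E₀[1_{λ ≤ |F|}] ≤ (2r−1)^{r·d} · σ₂^r / λ^{2r}`. -/
theorem gaussAvg_indicator_le_pow_of_polyCert_of_le (H : ℕ) {β : ℝ} (hβ : 0 < β) {F : (LandauFree H → E3) → ℝ} {d : ℕ}
    (hF : ∃ Q : MvPolynomial (LandauFree H × Fin 3) ℝ, Q.totalDegree ≤ d ∧ ∀ a, F a = MvPolynomial.eval (flatten (LandauFree H) a) Q)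
    {A : Set (LandauFree H → E3)} {lam σ₂ : ℝ} (hlam : 0 < lam) (hA : ∀ a ∈ A, lam ≤ |F a|)
    (hσ : gaussAvg β H (fun a => F a ^ 2) ≤ σ₂) (r : ℕ) (hr : 1 ≤ r) :
    gaussAvg β H (A.indicator fun _ => (1 : ℝ)) ≤ (2 * r - 1 : ℝ) ^ (r * d) * σ₂ ^ r / lam ^ (2 * r) := by
  have h0 : 0 ≤ gaussAvg β H (fun a => F a ^ 2) := gaussAvg_nonneg H hβ fun a => sq_nonneg _
  have hr0 : (0 : ℝ) ≤ (2 * r - 1 : ℝ) ^ (r * d) := by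
    have : (1 : ℝ) ≤ 2 * r := by exact_mod_cast (show 1 ≤ 2 * r by omega)
    exact pow_nonneg (by linarith) _
  refine (gaussAvg_indicator_le_pow_of_polyCert H hβ hF hlam hA r hr).trans ?_
  exact div_le_div_of_nonneg_right (mul_le_mul_of_nonneg_left (pow_le_pow_left₀ h0 hσ r) hr0) (by positivity)

/-- **Restricted form**: `E₀[sfInd·1_{λ ≤ |F|}] ≤ E₀[1_{λ ≤ |F|}] ≤ (2r−1)^{r·d} · E₀[F²]^r / λ^{2r}` (`0 ≤ sfInd ≤ 1`). -/
theorem gaussAvg_sfInd_mul_indicator_le_pow_of_polyCert (H : ℕ) {β : ℝ} (hβ : 0 < β) {F : (LandauFree H → E3) → ℝ} {d : ℕ}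
    (hF : ∃ Q : MvPolynomial (LandauFree H × Fin 3) ℝ, Q.totalDegree ≤ d ∧ ∀ a, F a = MvPolynomial.eval (flatten (LandauFree H) a) Q)
    (s : ℝ) {A : Set (LandauFree H → E3)} {lam : ℝ} (hlam : 0 < lam) (hA : ∀ a ∈ A, lam ≤ |F a|) (r : ℕ) (hr : 1 ≤ r) :
    gaussAvg β H (fun a => sfInd H s a * A.indicator (fun _ => (1 : ℝ)) a) ≤
      (2 * r - 1 : ℝ) ^ (r * d) * gaussAvg β H (fun a => F a ^ 2) ^ r / lam ^ (2 * r) := by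
  have hint : Integrable fun a : LandauFree H → E3 => F a ^ (2 * r) * gaussWeight β H a :=
    integrable_polyCert_mul_gaussWeight H hβ (polyCert_pow hF (2 * r))
  have hdom : Integrable fun a : LandauFree H → E3 => (lam ^ (2 * r))⁻¹ * F a ^ (2 * r) * gaussWeight β H a := by
    have := hint.const_mul ((lam ^ (2 * r))⁻¹)
    exact this.congr (Filter.Eventually.of_forall fun a => by ring)
  have hsf : ∀ a : LandauFree H → E3, 0 ≤ sfInd H s a ∧ sfInd H s a ≤ 1 := fun a => by
    unfold sfInd Set.indicator
    split_ifs <;> norm_num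
  have hind0 : ∀ a : LandauFree H → E3, 0 ≤ A.indicator (fun _ => (1 : ℝ)) a :=
    fun a => Set.indicator_nonneg (fun _ _ => zero_le_one) a
  have hmono := gaussAvg_mono_of_nonneg H hβ (F := fun a => sfInd H s a * A.indicator (fun _ => (1 : ℝ)) a)
    (G := fun a => (lam ^ (2 * r))⁻¹ * F a ^ (2 * r))
    (fun a => mul_nonneg (hsf a).1 (hind0 a))
    (fun a => by
      calc sfInd H s a * A.indicator (fun _ => (1 : ℝ)) a
          ≤ 1 * A.indicator (fun _ => (1 : ℝ)) a := mul_le_mul_of_nonneg_right (hsf a).2 (hind0 a)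
        _ ≤ (lam ^ (2 * r))⁻¹ * F a ^ (2 * r) := by
            rw [one_mul]; exact (indicator_le_pow_div F hlam hA r a).trans (le_of_eq (by ring))) hdom
  rw [gaussAvg_const_mul] at hmono
  have hpow := gaussAvg_pow_even_le_of_polyCert H hβ hF r hr
  have hl0 : 0 < (lam ^ (2 * r))⁻¹ := by positivity
  calc gaussAvg β H (fun a => sfInd H s a * A.indicator (fun _ => (1 : ℝ)) a)
      ≤ (lam ^ (2 * r))⁻¹ * gaussAvg β H (fun a => F a ^ (2 * r)) := hmono
    _ ≤ (lam ^ (2 * r))⁻¹ * ((2 * r - 1 : ℝ) ^ (r * d) * gaussAvg β H (fun a => F a ^ 2) ^ r) :=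
        mul_le_mul_of_nonneg_left hpow hl0.le
    _ = (2 * r - 1 : ℝ) ^ (r * d) * gaussAvg β H (fun a => F a ^ 2) ^ r / lam ^ (2 * r) := by
        rw [div_eq_mul_inv]; ring

end EdgeChartGaussian

end Summit.QuantumFields.YangMills.Theorems.AllWindowsColdBoxBoxHighLine

end
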